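import Literature.Geometry.GaugeTheory.AsdModuliSpace
import HarnessLib

/-!
# The stress–energy identity of an anti-self-dual 2-form in a frame

Topic `Literature/Geometry/GaugeTheory` (frame-level algebra for `AsdModuliSpace.lean`'s `IsASDIn`).

For an `ℍ`-valued 2-form `F` which is anti-self-dual in a 4-frame `e` (`IsASDIn F e`:
`F₀₁ + F₂₃ = F₀₂ + F₃₁ = F₀₃ + F₁₂ = 0`, Labastida–Mariño (2.19)) and skew (`F_ba = −F_ab`), the
contraction of `F` with itself over one index is pure trace:

`Σ_c ⟪F_ac, F_bc⟫ = δ_ab · ¼ Σ_{c,d} ‖F_cd‖² = δ_ab · ½ Σ_{c<d} ‖F_cd‖²`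

(`IsASDIn.sum_inner_eq`). This is the vanishing of the (trace-free) Yang–Mills stress–energy tensor
`T_ab = Σ_c ⟪F_ac, F_bc⟫ − ¼ δ_ab |F|²` on (anti-)self-dual fields, equivalently the identity
`(ι_X F, ι_Y F) = ½ (X, Y)(F, F)` for `F ∈ Λ²_∓ ⊗ 𝔤` which Groisser–Murray use in the proof of
their Lemma 3.2 (1997, §3, p. 6: "since `F` is self-dual, `(F, θ^i ∧ ι_{∇_i X} F) =
(ι_{e_i}F, ι_{∇_i X}F) = ½ (e_i, ∇_i X)(F, F)` (see [GP2], Lemma 3.4)"; [GP2] = Groisser–Parker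
1989). The proof is the sixteen-case check in the three independent components `F₀₁, F₀₂, F₀₃`
(`F₂₃ = −F₀₁`, `F₁₃ = F₀₂`, `F₁₂ = −F₀₃`); it uses only the real inner product of `ℍ`, so it holds
verbatim for the invariant inner product `−tr(ξη) = 2⟪ξ, η⟫` on `𝔰𝔭(1)` (`adNormSq = 2‖·‖²`).

## References

* [GroisserMurray1997] D. Groisser, M. K. Murray, Ann. Global Anal. Geom. 15 (1997), §3, proof of
  Lemma 3.2, p. 6 (quoting Groisser–Parker, J. Differential Geom. 29 (1989), Lemma 3.4).
* [LabastidaMarino2005] J. Labastida, M. Mariño, *Topological Quantum Field Theory and Four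
  Manifolds* (2005), (2.18)–(2.19) (the frame components of `F^±`).
-/

noncomputable section

open scoped RealInnerProductSpace Quaternion

namespace Literature.Geometry.GaugeTheory

variable {V : Type*}

/-- In `ℍ` (characteristic zero), `x = −x` forces `x = 0`; used for the diagonal `F_aa = 0` of a
skew form. [folklore] -/
theorem Quaternion.eq_zero_of_eq_neg {x : ℍ} (h : x = -x) : x = 0 := by
  have h2 : (2 : ℝ) • x = 0 := by
    rw [two_smul]
    nth_rewrite 2 [h]
    exact add_neg_cancel x
  exact (smul_eq_zero.1 h2).resolve_left two_ne_zero

/-- The three anti-self-duality relations of `IsASDIn F e`, unpacked: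
`F₀₁ = −F₂₃`, `F₀₂ = −F₃₁`, `F₀₃ = −F₁₂` (Labastida–Mariño 2005, (2.19)).
[cite: LabastidaMarino2005, (2.19)] -/
theorem IsASDIn.rel {F : V → V → ℍ} {e : Fin 4 → V} (h : IsASDIn F e) :
    F (e 0) (e 1) = -F (e 2) (e 3) ∧ F (e 0) (e 2) = -F (e 3) (e 1) ∧
      F (e 0) (e 3) = -F (e 1) (e 2) := by
  have h0 := congrFun h 0
  have h1 := congrFun h 1
  have h2 := congrFun h 2
  simp only [sdComponents, Fin.isValue, Matrix.cons_val_zero, Matrix.cons_val_one,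
    Matrix.cons_val, Pi.zero_apply] at h0 h1 h2
  exact ⟨eq_neg_of_add_eq_zero_left h0, eq_neg_of_add_eq_zero_left h1,
    eq_neg_of_add_eq_zero_left h2⟩

/-- **Stress–energy identity for anti-self-dual 2-forms.** If `F` is anti-self-dual in the frame
`e` and skew on it, then for all frame indices `a, b`,
`Σ_c ⟪F(e_a, e_c), F(e_b, e_c)⟫ = δ_ab · ¼ Σ_c Σ_d ‖F(e_c, e_d)‖²`:
the off-diagonal contractions vanish and each row carries a quarter of the total (ordered) sum of
squares, i.e. half of `Σ_{c<d} ‖F_cd‖²` — the frame form of `(ι_X F, ι_Y F) = ½(X,Y)|F|²`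
(Groisser–Murray 1997, proof of Lemma 3.2, after Groisser–Parker 1989, Lemma 3.4), equivalently
`T_ab = 0` for the Yang–Mills stress–energy tensor of an instanton.
[cite: GroisserMurray1997, §3, proof of Lemma 3.2, p. 6] -/
theorem IsASDIn.sum_inner_eq {F : V → V → ℍ} {e : Fin 4 → V} (hF : IsASDIn F e)
    (hskew : ∀ a b : Fin 4, F (e b) (e a) = -F (e a) (e b)) (a b : Fin 4) :
    ∑ c, ⟪F (e a) (e c), F (e b) (e c)⟫ =
      if a = b then (1 / 4 : ℝ) * ∑ c, ∑ d, ‖F (e c) (e d)‖ ^ 2 else 0 := by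
  obtain ⟨h01, h02, h03⟩ := hF.rel
  -- the diagonal vanishes
  have h00 : F (e 0) (e 0) = 0 := Quaternion.eq_zero_of_eq_neg (hskew 0 0)
  have h11 : F (e 1) (e 1) = 0 := Quaternion.eq_zero_of_eq_neg (hskew 1 1)
  have h22 : F (e 2) (e 2) = 0 := Quaternion.eq_zero_of_eq_neg (hskew 2 2)
  have h33 : F (e 3) (e 3) = 0 := Quaternion.eq_zero_of_eq_neg (hskew 3 3)
  -- everything in terms of `p = F₀₁`, `q = F₀₂`, `r = F₀₃`
  set p := F (e 0) (e 1) with hp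
  set q := F (e 0) (e 2) with hq
  set r := F (e 0) (e 3) with hr
  have h10 : F (e 1) (e 0) = -p := hskew 0 1
  have h20 : F (e 2) (e 0) = -q := hskew 0 2
  have h30 : F (e 3) (e 0) = -r := hskew 0 3
  have h23 : F (e 2) (e 3) = -p := by rw [h01, neg_neg]
  have h12 : F (e 1) (e 2) = -r := by rw [h03, neg_neg]
  have h13 : F (e 1) (e 3) = q := by rw [h02, hskew 1 3, neg_neg]
  have h21 : F (e 2) (e 1) = r := by rw [hskew 1 2, h12, neg_neg]
  have h31 : F (e 3) (e 1) = -q := by rw [hskew 1 3, h13]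
  have h32 : F (e 3) (e 2) = p := by rw [hskew 2 3, h23, neg_neg]
  fin_cases a <;> fin_cases b <;>
    simp only [Fin.sum_univ_four, Fin.isValue, Fin.zero_eta, Fin.mk_one, Fin.reduceFinMk,
      h00, h11, h22, h33, h10, h20, h30, h23, h12, h13, h21, h31, h32,
      inner_neg_left, inner_neg_right, inner_zero_left, inner_zero_right, norm_neg, norm_zero,
      real_inner_self_eq_norm_sq, real_inner_comm, if_true, if_false, Fin.reduceEq] <;>
    ring

/-- **Diagonal case, in `Σ_{c<d}` form:** for `F` anti-self-dual and skew in the frame `e`, every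
row sum of squares is half the sum over `c < d`: `Σ_c ‖F(e_a,e_c)‖² = ½ Σ_{c<d} ‖F(e_c,e_d)‖²`
(so with `adNormSq = 2‖·‖²`, `Σ_c |F_ac|² = ½ |F|²` in the normalisation of `twoFormNormSq`).
[cite: GroisserMurray1997, §3, proof of Lemma 3.2, p. 6] -/
theorem IsASDIn.sum_norm_sq_eq {F : V → V → ℍ} {e : Fin 4 → V} (hF : IsASDIn F e)
    (hskew : ∀ a b : Fin 4, F (e b) (e a) = -F (e a) (e b)) (a : Fin 4) :
    ∑ c, ‖F (e a) (e c)‖ ^ 2 =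
      (1 / 2 : ℝ) * ∑ c, ∑ d, if c < d then ‖F (e c) (e d)‖ ^ 2 else 0 := by
  obtain ⟨h01, h02, h03⟩ := hF.rel
  have h00 : F (e 0) (e 0) = 0 := Quaternion.eq_zero_of_eq_neg (hskew 0 0)
  have h11 : F (e 1) (e 1) = 0 := Quaternion.eq_zero_of_eq_neg (hskew 1 1)
  have h22 : F (e 2) (e 2) = 0 := Quaternion.eq_zero_of_eq_neg (hskew 2 2)
  have h33 : F (e 3) (e 3) = 0 := Quaternion.eq_zero_of_eq_neg (hskew 3 3)
  set p := F (e 0) (e 1) with hp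
  set q := F (e 0) (e 2) with hq
  set r := F (e 0) (e 3) with hr
  have h10 : F (e 1) (e 0) = -p := hskew 0 1
  have h20 : F (e 2) (e 0) = -q := hskew 0 2
  have h30 : F (e 3) (e 0) = -r := hskew 0 3
  have h23 : F (e 2) (e 3) = -p := by rw [h01, neg_neg]
  have h12 : F (e 1) (e 2) = -r := by rw [h03, neg_neg]
  have h13 : F (e 1) (e 3) = q := by rw [h02, hskew 1 3, neg_neg]
  have h21 : F (e 2) (e 1) = r := by rw [hskew 1 2, h12, neg_neg]
  have h31 : F (e 3) (e 1) = -q := by rw [hskew 1 3, h13]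
  have h32 : F (e 3) (e 2) = p := by rw [hskew 2 3, h23, neg_neg]
  fin_cases a <;>
    simp only [Fin.sum_univ_four, Fin.isValue, Fin.zero_eta, Fin.mk_one, Fin.reduceFinMk,
      h00, h11, h22, h33, h10, h20, h30, h23, h12, h13, h21, h31, h32, norm_neg, norm_zero,
      Fin.reduceLT, if_true, if_false] <;>
    ring

end Literature.Geometry.GaugeTheory

end
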